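import Mathlib
import HarnessLib
import Summits.QuantumFields.YangMills.Theorems.HypercubicLimit.Negative.ReflectedDensity
import Summits.QuantumFields.YangMills.Theorems.FradkinShenkerFlowFiniteSusceptibilityWeakCouplingRPCauchySchwarz
import Literature.MathematicalPhysics.AQFT.OSAxiomsSchwinger
import Literature.MathematicalPhysics.QuantumFieldTheory.OSData
import Literature.MathematicalPhysics.QuantumLattice.LatticeScalarField
import Literature.MathematicalPhysics.QuantumFieldTheory.LatticeGaugeStaticPotentialProofs
import Literature.Probability.LatticeModels.ThermodynamicLimit
import Literature.MathematicalPhysics.QuantumFieldTheory.SchwingerLimitInheritance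

/-!
# Block E4-inh: the cluster property is inherited along pointwise limits on `⁰𝒮`

Stub `rpBlock_clusterInheritance` of line `conditional-mean-telescoping` (crux
`stmt-QuantumFields-8646`, c1 seat).

If `S j n F → T n F` for every `F ∈ ⁰𝒮ₙ` and, for every pair of time-ordered `F, G`, every
non-zero purely spatial `a` and every family of witnesses `H t` of `ΘF* ⊗ G(· − t a)`, for every
`δ > 0` there is `t₀` beyond which the truncated quantity
`‖S j (H t) − S j (ΘF*) S j (G)‖` is eventually (in `j`) at most `δ`, then `T` has the OS cluster
property E4.

Proof.  Fix the data of E4 for `T.toLabelled` (labels are `Unit` and drop out by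
`toLabelled_apply`).  For every `t`, the witness `H t` lies in `⁰𝒮`
(`IsAppendTensorOf.isOffDiagonal_of_isTimeOrdered`; the spatial translate `G(· − t a)` is still
time-ordered since `(t • a)⁰ = 0`, `OSReconstructionNoE1.isTimeOrdered_translateMulti`), and so
do `ΘF*` (`IsOffDiagonal.osAdjoint`) and `G` (`IsTimeOrdered.isOffDiagonal`); hence the
truncated quantity at level `j` converges to the one of `T` (`clInh_tendsto_truncated`).  Given
`δ > 0`, take `t₀` from the hypothesis with `δ / 2`; for `t ≥ t₀` the eventual bound `≤ δ / 2`
passes to the limit (`le_of_tendsto`), giving `‖T (H t) − T (ΘF*) T (G)‖ ≤ δ / 2 < δ`, which is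
`Metric.tendsto_atTop`.
-/

noncomputable section

open scoped SchwartzMap ComplexConjugate
open MeasureTheory Filter Topology
open Literature.MathematicalPhysics.AQFT Literature.MathematicalPhysics.QuantumLattice
open Literature.MathematicalPhysics.QuantumFieldTheory
open Literature.Probability.LatticeModels (box Site)
open Summit.QuantumFields.YangMills.Theorems.HypercubicLimit.Negative (torusPlaquette thetaZ)

namespace Summit.QuantumFields.YangMills.Cruxes.HypercubicLimit.ConditionalMeanTelescoping

/-- A purely spatial translate `G(· − t a)` (`a⁰ = 0`) of a time-ordered test function is
time-ordered: the time coordinates are unchanged. [folklore] -/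
theorem clInh_isTimeOrdered_translateMulti_spatial {d : ℕ} [NeZero d] {m : ℕ}
    {G : 𝓢((Fin m → EuclideanSpace ℝ (Fin d)), ℂ)} (hG : IsTimeOrdered G)
    {a : EuclideanSpace ℝ (Fin d)} (ha : a 0 = 0) (t : ℝ) :
    IsTimeOrdered (translateMulti (t • a) G) :=
  OSReconstructionNoE1.isTimeOrdered_translateMulti hG (by simp [ha])

/-- **Convergence of the truncated quantity.** If `S j → T` pointwise on `⁰𝒮`, `F, G` are
time-ordered, `a` is purely spatial and `H` is a witness of `ΘF* ⊗ G(· − t a)`, then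
`‖S j (H) − S j (ΘF*) S j (G)‖ → ‖T (H) − T (ΘF*) T (G)‖` as `j → ∞` (all three test functions
lie in `⁰𝒮`). [folklore] -/
theorem clInh_tendsto_truncated {d : ℕ} [NeZero d]
    {S : ℕ → SchwingerFamily (EuclideanSpace ℝ (Fin d))}
    {T : SchwingerFamily (EuclideanSpace ℝ (Fin d))}
    (hconv : ∀ (n : ℕ) (F : 𝓢((Fin n → EuclideanSpace ℝ (Fin d)), ℂ)), IsOffDiagonal F →
      Tendsto (fun j => S j n F) atTop (𝓝 (T n F)))
    {n m : ℕ} {F : 𝓢((Fin n → EuclideanSpace ℝ (Fin d)), ℂ)}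
    {G : 𝓢((Fin m → EuclideanSpace ℝ (Fin d)), ℂ)} (hF : IsTimeOrdered F) (hG : IsTimeOrdered G)
    {a : EuclideanSpace ℝ (Fin d)} (ha : a 0 = 0) (t : ℝ)
    {H : 𝓢((Fin (n + m) → EuclideanSpace ℝ (Fin d)), ℂ)}
    (hH : IsAppendTensorOf H (osAdjoint F) (translateMulti (t • a) G)) :
    Tendsto (fun j => ‖S j (n + m) H - S j n (osAdjoint F) * S j m G‖) atTop
      (𝓝 ‖T (n + m) H - T n (osAdjoint F) * T m G‖) := by
  have hHo : IsOffDiagonal H :=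
    hH.isOffDiagonal_of_isTimeOrdered hF (clInh_isTimeOrdered_translateMulti_spatial hG ha t)
  exact ((hconv _ H hHo).sub
    ((hconv n _ hF.isOffDiagonal.osAdjoint).mul (hconv m G hG.isOffDiagonal))).norm

/-- **Block E4-inh (the cluster property is inherited along pointwise limits on `⁰𝒮`).** If
`S j → T` on `⁰𝒮` and, for every pair of time-ordered `F, G`, every non-zero spatial `a` and every
family of witnesses `H t` of `ΘF* ⊗ G(· − t a)`, for every `δ > 0` there is `t₀` beyond which the
truncated quantity is eventually (in `j`) at most `δ`, then `T` has the cluster property E4. -/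
theorem rpBlock_clusterInheritance :
    ∀ (d : ℕ) [NeZero d] (S : ℕ → SchwingerFamily (EuclideanSpace ℝ (Fin d)))
      (T : SchwingerFamily (EuclideanSpace ℝ (Fin d))),
      (∀ (n : ℕ) (F : 𝓢((Fin n → EuclideanSpace ℝ (Fin d)), ℂ)), IsOffDiagonal F →
        Tendsto (fun j => S j n F) atTop (𝓝 (T n F))) →
      (∀ (n m : ℕ) (F : 𝓢((Fin n → EuclideanSpace ℝ (Fin d)), ℂ))
          (G : 𝓢((Fin m → EuclideanSpace ℝ (Fin d)), ℂ)), IsTimeOrdered F → IsTimeOrdered G →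
        ∀ a : EuclideanSpace ℝ (Fin d), a 0 = 0 → a ≠ 0 →
          ∀ H : ℝ → 𝓢((Fin (n + m) → EuclideanSpace ℝ (Fin d)), ℂ),
            (∀ t, IsAppendTensorOf (H t) (osAdjoint F) (translateMulti (t • a) G)) →
              ∀ δ : ℝ, 0 < δ → ∃ t₀ : ℝ, ∀ t : ℝ, t₀ ≤ t → ∀ᶠ j in atTop,
                ‖S j (n + m) (H t) - S j n (osAdjoint F) * S j m G‖ ≤ δ) →
      (SchwingerFamily.toLabelled T).HasClusterProperty := by
  intro d _ S T hconv hcl n m k k' F G hF hG a ha0 ha H hH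
  simp only [SchwingerFamily.toLabelled_apply]
  rw [Metric.tendsto_atTop]
  intro δ hδ
  obtain ⟨t₀, ht₀⟩ := hcl n m F G hF hG a ha0 ha H hH (δ / 2) (half_pos hδ)
  refine ⟨t₀, fun t ht => ?_⟩
  have hle : ‖T (n + m) (H t) - T n (osAdjoint F) * T m G‖ ≤ δ / 2 :=
    le_of_tendsto (clInh_tendsto_truncated hconv hF hG ha0 t (hH t)) (ht₀ t ht)
  rw [dist_zero_right]
  linarith

end Summit.QuantumFields.YangMills.Cruxes.HypercubicLimit.ConditionalMeanTelescoping
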